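import Summits.AtomisticToContinuum.HydrodynamicLimit.Theorems.BoltzmannGreenKubo.Negative.QuadraticStatics
import Summits.AtomisticToContinuum.HydrodynamicLimit.Theorems.BoltzmannGreenKubo.Negative.TimeAverage
import Literature.Analysis.FluidPDE.HardSphereMomentumConservation

/-!
# A QUADRATIC Mazur floor: the hidden conserved charge `P₀P₁` carries Drude weight `Θ(1/N)` per particle

Negative-knowledge infrastructure for the crux `AntiMazurCoboundaries.BoltzmannGreenKubo` (stmt-AtomisticToContinuum-13985),
from the standing disprover's `Cruxes/BoltzmannGreenKubo/Disproof.lean` §2d (gen 2); consumed by `Negative/N0BeforeS.lean`.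
Although `g_B ⊥ span(1, v, |v|²)` projects out all three LINEAR conserved charges, the product `Q_B = P₀P₁` of two conserved
momentum components is still conserved by the hard-sphere dynamics (`QB_flow`), with `E_{G_N}[F_B·Q_B] = (N+1)·m_B`,
`m_B > 0` (`mB_pos` below), `E_{G_N}[Q_B²] = (N+1)²` (`Negative/QuadraticStatics`, transferred through the Gaussian velocity marginal). Mazur's
inequality (Cauchy–Schwarz against `Q_B`; `E[A·Q_B] = E[F_B·Q_B]` by Fubini + stationarity + conservation, exactly as
`mazur_floor`) gives the kernel-checked `quadratic_mazur_floor`: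
`E_{G_N}[(h⁻¹∫₀ʰ Σᵢ g_B(vᵢ(r)) dr)²] ≥ m_B²` for EVERY `N`, `σ ≤ 1/2`, `h > 0` — a Drude weight `m_B²/(N+1) = Θ(1/N)` PER PARTICLE
that no window removes: at FIXED `N` the kinetic-window functional times `s` diverges linearly as `s → ∞`. This mechanises
the readback's "hidden nonlinear charges are `O(1/N)`" (with the sharp order) and is why `N₀` must grow at least
linearly with `s` (`N₀ + 1 ≥ s·m_B²/(2∫φ²D + η)`).
refuter-cdisprove-stmt-AtomisticToContinuum-13985-g2-0.
-/

noncomputable section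

namespace Summit.AtomisticToContinuum.HydrodynamicLimit.Theorems

open MeasureTheory ProbabilityTheory Filter Topology Set
open Literature.Analysis.FluidPDE Literature.MathematicalPhysics.KineticTheory
open Literature.Analysis.UnboundedOperators
open scoped InnerProductSpace
open BoltzmannGreenKuboForallN BoltzmannGreenKuboOrthMomentum

namespace BoltzmannGreenKuboQuadraticMazur

/-! ### `m_B > 0` -/

/-- Coordinate hyperplanes are `γ`-null (the coordinate marginal is `N(0,1)`, which has no atoms). [folklore] -/
theorem stdGaussian_coord_eq_zero (c : Fin 3) : stdGaussian V3 {w | w c = 0} = 0 := by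
  have h3 := (measurePreserving_coord c).measure_preimage
    ((measurableSet_singleton (0 : ℝ)).nullMeasurableSet (μ := gaussianReal 0 1))
  haveI := nullSingletonClass_gaussianReal (μ := (0 : ℝ)) (v := 1) one_ne_zero
  rw [measure_singleton] at h3
  simpa [Set.preimage] using h3

/-- Continuity of the coordinates of `ℝ³`. [folklore] -/
theorem continuous_coord (c : Fin 3) : Continuous fun w : V3 => w c :=
  (EuclideanSpace.proj (𝕜 := ℝ) c).continuous

/-- **`m_B > 0`**: the integrand `g_B(w)w₀w₁ = w₀²w₁²/(1+|w|²)` is nonnegative, continuous, integrable, and vanishes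
only on the two `γ`-null hyperplanes `{w₀ = 0}`, `{w₁ = 0}`. [folklore] -/
theorem mB_pos : 0 < mB := by
  set f : V3 → ℝ := fun w => gB w * (w 0 * w 1) with hf
  have hfeq : ∀ w, f w = (w 0) ^ 2 * (w 1) ^ 2 * (1 + ‖w‖ ^ 2)⁻¹ := fun w => by
    simp only [hf, gB_apply]; ring
  have hnn : 0 ≤ f := fun w => by rw [Pi.zero_apply, hfeq]; positivity
  have hmeas : Measurable f := continuous_gB.measurable.mul ((measurable_coord 0).mul (measurable_coord 1))
  have hint : Integrable f (stdGaussian V3) := by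
    have hdom : Integrable (fun w : V3 => ((w 0) ^ 2 + (w 1) ^ 2) / 2) (stdGaussian V3) :=
      ((integrable_coord_sq' 0).add (integrable_coord_sq' 1)).div_const 2
    refine hdom.mono' hmeas.aestronglyMeasurable (Eventually.of_forall fun w => ?_)
    rw [Real.norm_eq_abs, hf]
    simp only
    rw [abs_mul]
    have h1 := abs_gB_le w
    have h2 : |w 0 * w 1| ≤ ((w 0) ^ 2 + (w 1) ^ 2) / 2 := by
      rw [abs_le]
      constructor <;> nlinarith [sq_nonneg (w 0 + w 1), sq_nonneg (w 0 - w 1)]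
    nlinarith [abs_nonneg (gB w), abs_nonneg (w 0 * w 1)]
  have hsupp : Function.support f = {w | w 0 = 0}ᶜ ∩ {w | w 1 = 0}ᶜ := by
    ext w
    simp only [Function.mem_support, ne_eq, Set.mem_inter_iff, Set.mem_compl_iff, Set.mem_setOf_eq, hfeq]
    have hpos : 0 < (1 + ‖w‖ ^ 2)⁻¹ := by positivity
    constructor
    · intro h
      constructor
      · intro h0; apply h; rw [h0]; ring
      · intro h1; apply h; rw [h1]; ring
    · rintro ⟨h0, h1⟩
      have : 0 < (w 0) ^ 2 * (w 1) ^ 2 * (1 + ‖w‖ ^ 2)⁻¹ := by positivity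
      exact this.ne'
  have hnull : stdGaussian V3 (Function.support f)ᶜ = 0 := by
    rw [hsupp, Set.compl_inter, compl_compl, compl_compl]
    exact measure_union_null (stdGaussian_coord_eq_zero 0) (stdGaussian_coord_eq_zero 1)
  have hsupp_pos : 0 < stdGaussian V3 (Function.support f) := by
    have h1 : stdGaussian V3 Set.univ ≤ stdGaussian V3 (Function.support f) + stdGaussian V3 (Function.support f)ᶜ :=
      measure_univ_le_add_compl _
    rw [hnull, add_zero, measure_univ] at h1
    exact lt_of_lt_of_le one_pos h1
  exact (integral_pos_iff_support_of_nonneg hnn hint).2 hsupp_pos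

/-! ### On phase space: conservation of `Q_B`, transfer of the statics, and the floor -/

section Floor

variable {σ : ℝ} {N : ℕ}

/-- `F_B(w) = Σᵢ g_B(vᵢ)` on phase space. [folklore] -/
def FB (w : Config (N + 1) (Fin 3) T3) : ℝ := ∑ i, gB (w i).2

/-- The quadratic conserved charge `Q_B = P₀P₁` on phase space. [folklore] -/
def QB (w : Config (N + 1) (Fin 3) T3) : ℝ := (configMomentum w) 0 * (configMomentum w) 1

/-- `F_B` factors through the velocities. [folklore] -/
theorem FB_eq_velOf (w : Config (N + 1) (Fin 3) T3) : FB w = FBv (velOf w) := rfl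

/-- `Q_B` factors through the velocities. [folklore] -/
theorem QB_eq_velOf (w : Config (N + 1) (Fin 3) T3) : QB w = QBv (velOf w) := by
  simp [QB, QBv, Pv, velOf, configMomentum]

/-- `F_B` is measurable. [folklore] -/
theorem measurable_FB : Measurable (FB : Config (N + 1) (Fin 3) T3 → ℝ) :=
  measurable_FBv.comp measurable_velOf

/-- `Q_B` is measurable. [folklore] -/
theorem measurable_QB : Measurable (QB : Config (N + 1) (Fin 3) T3 → ℝ) := by
  rw [show (QB : Config (N + 1) (Fin 3) T3 → ℝ) = fun w => QBv (velOf w) from funext QB_eq_velOf]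
  exact measurable_QBv.comp measurable_velOf

/-- `|F_B| ≤ N + 1`. [folklore] -/
theorem abs_FB_le (w : Config (N + 1) (Fin 3) T3) : |FB w| ≤ (N : ℝ) + 1 := by
  have := abs_FBv_le (velOf w)
  rw [FB_eq_velOf]
  exact_mod_cast this

/-- **`Q_B` is conserved** along every hard-sphere flow on its good set (momentum conservation). [folklore] -/
theorem QB_flow (Φ : HardSphereFlow (Torus.geometry (Fin 3)) (hsDiameter σ N) (N + 1))
    {z : Config (N + 1) (Fin 3) T3} (hz : z ∈ Φ.good) (t : ℝ) : QB (Φ.flow t z) = QB z := by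
  unfold QB
  rw [Φ.configMomentum_flow hz t]

/-- `F_B` is integrable under `G_N`. [folklore] -/
theorem integrable_FB (Φ : HardSphereFlow (Torus.geometry (Fin 3)) (hsDiameter σ N) (N + 1))
    [IsProbabilityMeasure (localGibbsLaw σ (fun _ => 1) (fun _ => 0) (fun _ => 1) N Φ)] :
    Integrable (FB : Config (N + 1) (Fin 3) T3 → ℝ) (localGibbsLaw σ (fun _ => 1) (fun _ => 0) (fun _ => 1) N Φ) :=
  (integrable_const ((N : ℝ) + 1)).mono' measurable_FB.aestronglyMeasurable
    (Eventually.of_forall fun w => by rw [Real.norm_eq_abs]; exact abs_FB_le w)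

/-- `Q_B²` is integrable under `G_N` and `E_{G_N}[Q_B²] = (N+1)²`. [folklore] -/
theorem integral_QB_sq_eq (hσ : σ ≤ 1 / 2)
    (Φ : HardSphereFlow (Torus.geometry (Fin 3)) (hsDiameter σ N) (N + 1)) :
    Integrable (fun z => QB z ^ 2) (localGibbsLaw σ (fun _ => 1) (fun _ => 0) (fun _ => 1) N Φ) ∧
    ∫ z, QB z ^ 2 ∂(localGibbsLaw σ (fun _ => 1) (fun _ => 0) (fun _ => 1) N Φ) = ((N : ℝ) + 1) ^ 2 := by
  have h1 := integrable_QBv_sq (n := N + 1)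
  have h2 := integral_QBv_sq_eq (n := N + 1)
  have hcast : ((N + 1 : ℕ) : ℝ) = (N : ℝ) + 1 := by push_cast; ring
  rw [hcast] at h2
  have e : (fun z : Config (N + 1) (Fin 3) T3 => QB z ^ 2) = fun z => (fun v : Fin (N + 1) → V3 => QBv v ^ 2) (velOf z) :=
    funext fun z => by rw [QB_eq_velOf]
  rw [e]
  refine ⟨integrable_velOf_localGibbsLaw hσ N Φ (H := fun v : Fin (N + 1) → V3 => QBv v ^ 2) h1, ?_⟩
  rw [integral_velOf_localGibbsLaw hσ N Φ (H := fun v : Fin (N + 1) → V3 => QBv v ^ 2) (measurable_QBv.pow_const 2)]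
  exact h2

/-- `Q_B` is integrable under `G_N`. [folklore] -/
theorem integrable_QB (hσ : σ ≤ 1 / 2)
    (Φ : HardSphereFlow (Torus.geometry (Fin 3)) (hsDiameter σ N) (N + 1)) :
    Integrable (QB : Config (N + 1) (Fin 3) T3 → ℝ) (localGibbsLaw σ (fun _ => 1) (fun _ => 0) (fun _ => 1) N Φ) := by
  rw [show (QB : Config (N + 1) (Fin 3) T3 → ℝ) = fun w => QBv (velOf w) from funext QB_eq_velOf]
  exact integrable_velOf_localGibbsLaw hσ N Φ (H := (QBv : (Fin (N + 1) → V3) → ℝ)) integrable_QBv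

/-- `F_B·Q_B` is integrable under `G_N` with `E_{G_N}[F_B Q_B] = (N+1) m_B`. [folklore] -/
theorem integral_FB_mul_QB (hσ : σ ≤ 1 / 2)
    (Φ : HardSphereFlow (Torus.geometry (Fin 3)) (hsDiameter σ N) (N + 1)) :
    Integrable (fun z => FB z * QB z) (localGibbsLaw σ (fun _ => 1) (fun _ => 0) (fun _ => 1) N Φ) ∧
    ∫ z, FB z * QB z ∂(localGibbsLaw σ (fun _ => 1) (fun _ => 0) (fun _ => 1) N Φ) = ((N : ℝ) + 1) * mB := by
  have e : (fun z : Config (N + 1) (Fin 3) T3 => FB z * QB z) =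
      fun z => (fun v : Fin (N + 1) → V3 => FBv v * QBv v) (velOf z) :=
    funext fun z => by rw [FB_eq_velOf, QB_eq_velOf]
  rw [e]
  refine ⟨integrable_velOf_localGibbsLaw hσ N Φ (H := fun v : Fin (N + 1) → V3 => FBv v * QBv v) integrable_FBv_mul_QBv, ?_⟩
  rw [integral_velOf_localGibbsLaw hσ N Φ (H := fun v : Fin (N + 1) → V3 => FBv v * QBv v)
    (measurable_FBv.mul measurable_QBv), integral_FBv_mul_QBv]
  push_cast
  ring

/-- **THE QUADRATIC MAZUR FLOOR.** For EVERY `N`, `σ ≤ 1/2`, `h > 0` and flow `Φ`: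
`E_{G_N}[(h⁻¹∫₀ʰ Σᵢ g_B(vᵢ(r)) dr)²] ≥ m_B²` — Cauchy–Schwarz against the conserved charge `Q_B = P₀P₁`
(`E[A·Q_B] = E[F_B·Q_B] = (N+1)m_B` by Fubini + stationarity + conservation; `E[Q_B²] = (N+1)²`). A Drude weight
`m_B²/(N+1) = Θ(1/N)` PER PARTICLE that survives every window although `g_B ⊥ span(1, v, |v|²)`. [folklore] -/
theorem quadratic_mazur_floor (hσ : σ ≤ 1 / 2)
    (Φ : HardSphereFlow (Torus.geometry (Fin 3)) (hsDiameter σ N) (N + 1)) {h : ℝ} (hh : 0 < h) :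
    mB ^ 2 ≤
      ∫ z, (h⁻¹ * ∫ r in (0 : ℝ)..h, FB (Φ.flow r z)) ^ 2 ∂(localGibbsLaw σ (fun _ => 1) (fun _ => 0) (fun _ => 1) N Φ) := by
  set G := localGibbsLaw σ (fun _ => (1 : ℝ)) (fun _ => (0 : V3)) (fun _ => (1 : ℝ)) N Φ with hGdef
  haveI : IsProbabilityMeasure G :=
    isProbabilityMeasure_localGibbsLaw continuous_const continuous_const
      continuous_const (fun _ => one_pos) (fun _ => one_pos) hσ N Φ
  obtain ⟨A, hA⟩ : ∃ A : Config (N + 1) (Fin 3) T3 → ℝ, A = fun z => h⁻¹ * ∫ r in (0 : ℝ)..h, FB (Φ.flow r z) :=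
    ⟨_, rfl⟩
  set n1 : ℝ := (N : ℝ) + 1 with hn1
  have hn1pos : 0 < n1 := by positivity
  -- pointwise bound on A
  have hAbd : ∀ z, |A z| ≤ n1 := by
    intro z
    have hI : ‖∫ r in (0 : ℝ)..h, FB (Φ.flow r z)‖ ≤ n1 * |h - 0| :=
      intervalIntegral.norm_integral_le_of_norm_le_const fun r _ => by
        rw [Real.norm_eq_abs]; exact abs_FB_le _
    rw [Real.norm_eq_abs, sub_zero, abs_of_pos hh] at hI
    rw [hA, abs_mul, abs_inv, abs_of_pos hh]
    calc h⁻¹ * |∫ r in (0 : ℝ)..h, FB (Φ.flow r z)| ≤ h⁻¹ * (n1 * h) :=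
          mul_le_mul_of_nonneg_left hI (by positivity)
      _ = n1 := by field_simp
  have hwin : Integrable (fun z => ∫ r in (0 : ℝ)..h, FB (Φ.flow r z)) G :=
    integrable_window 1 1 0 Φ measurable_FB (integrable_FB Φ) hh.le
  have hAm : AEStronglyMeasurable A G := by
    rw [hA]
    exact hwin.aestronglyMeasurable.const_mul _
  have hA2 : Integrable (fun z => A z ^ 2) G := by
    refine (integrable_const (n1 ^ 2)).mono' (hAm.pow 2) (Eventually.of_forall fun z => ?_)
    rw [Real.norm_eq_abs, abs_pow]
    exact pow_le_pow_left₀ (abs_nonneg _) (hAbd z) 2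
  have hQ := integrable_QB hσ Φ
  obtain ⟨hQ2, hQ2eq⟩ := integral_QB_sq_eq hσ Φ
  obtain ⟨hFQ, hFQeq⟩ := integral_FB_mul_QB hσ Φ
  have hAQ : Integrable (fun z => A z * QB z) G :=
    hQ.bdd_mul (c := n1) hAm (Eventually.of_forall fun z => by rw [Real.norm_eq_abs]; exact hAbd z)
  -- the key identity E[A Q] = (N+1) m_B
  have hkey : ∫ z, A z * QB z ∂G = n1 * mB := by
    have hae : (fun z => A z * QB z) =ᵐ[G] fun z => h⁻¹ * ∫ r in (0 : ℝ)..h, FB (Φ.flow r z) * QB (Φ.flow r z) := by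
      filter_upwards [ae_mem_good_localGibbsLaw' (N := N) 1 1 0 Φ] with z hz
      rw [hA]
      simp only [QB_flow Φ hz]
      rw [intervalIntegral.integral_mul_const, mul_assoc]
    rw [integral_congr_ae hae, integral_const_mul,
      integral_window_eq 1 1 0 Φ (X := fun w => FB w * QB w) (measurable_FB.mul measurable_QB) hFQ hh.le,
      ← mul_assoc, inv_mul_cancel₀ hh.ne', one_mul, hFQeq]
  -- Cauchy–Schwarz via a square, with the optimal multiplier
  set lam : ℝ := mB / n1 with hlam
  have hsq : 0 ≤ ∫ z, (A z - lam * QB z) ^ 2 ∂G := integral_nonneg fun z => sq_nonneg _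
  have e : (fun z => (A z - lam * QB z) ^ 2) =
      fun z => (A z ^ 2 - 2 * lam * (A z * QB z)) + lam ^ 2 * (QB z ^ 2) := by
    funext z; ring
  have i1 : ∫ z, (A z ^ 2 - 2 * lam * (A z * QB z)) + lam ^ 2 * (QB z ^ 2) ∂G =
      ∫ z, (A z ^ 2 - 2 * lam * (A z * QB z)) ∂G + ∫ z, lam ^ 2 * (QB z ^ 2) ∂G :=
    integral_add (hA2.sub (hAQ.const_mul (2 * lam))) (hQ2.const_mul (lam ^ 2))
  have i2 : ∫ z, (A z ^ 2 - 2 * lam * (A z * QB z)) ∂G = ∫ z, A z ^ 2 ∂G - ∫ z, 2 * lam * (A z * QB z) ∂G :=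
    integral_sub hA2 (hAQ.const_mul (2 * lam))
  have i3 : ∫ z, 2 * lam * (A z * QB z) ∂G = 2 * lam * (n1 * mB) := by
    rw [integral_const_mul, hkey]
  have i4 : ∫ z, lam ^ 2 * (QB z ^ 2) ∂G = lam ^ 2 * n1 ^ 2 := by
    rw [integral_const_mul, hQ2eq]
  rw [e, i1, i2, i3, i4] at hsq
  have hAA : ∫ z, A z ^ 2 ∂G = ∫ z, (h⁻¹ * ∫ r in (0 : ℝ)..h, FB (Φ.flow r z)) ^ 2 ∂G := by rw [hA]
  rw [← hAA]
  have hval : 2 * lam * (n1 * mB) - lam ^ 2 * n1 ^ 2 = mB ^ 2 := by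
    rw [hlam]
    field_simp
    ring
  linarith [hsq, hval]

end Floor

end BoltzmannGreenKuboQuadraticMazur

end Summit.AtomisticToContinuum.HydrodynamicLimit.Theorems

end
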